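import Mathlib
import Summits.ValiantsHypothesis.ValiantsHypothesis.Theorems.SuccinctLiftSmlConvolution

/-!
# SuccinctLift — the combinatorial logarithm and labelled class terms

Second support file of the characteristic-free set-multilinear product expansion (wall D of
`route-ValiantsHypothesis-SuccinctLift`, stmt-ValiantsHypothesis-23721, census cell W34): on the
subset-convolution algebra of `SuccinctLiftSmlConvolution.lean`, every `L` with `L ∅ = 1` is a
combinatorial exponential `pexp M` where each `M Q` lies in the span of the products `∏_{P ∈ ρ} L P`
over set partitions `ρ ⊢ Q` (`exists_plog`; triangular recursion on `|Q|`, integer coefficients, NO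
division — this is the point of Forbes's "over any field" version of the Limaye–Srinivasan–Tavenas
set-multilinearisation), and set partitions of `S` are indexed by LABELLINGS `e : ι → ι` (a class is a
nonempty fibre), so that partition sums become sums over the `|ι|^|ι|` labelled terms `labTerm N S e`
(`exists_labelling`, `pexp_mem_span_labTerm`).

References: Forbes2024LowDepth (CCC 2024, Thm. 1, §1.2); LimayeSrinivasanTavenas2025 (Lemma 12).
-/

noncomputable section

open MvPolynomial Finset

-- the summit and the problem share the name `ValiantsHypothesis` (D-0017 single-conjunct layout)
set_option linter.dupNamespace false

namespace Summit.ValiantsHypothesis.ValiantsHypothesis.Theorems.SuccinctLiftSmlPlog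

open Literature.Computability.AlgebraicComplexity SuccinctLiftSmlConvolution

universe u v w

section Plog

variable {α : Type u} [CommRing α] {ι : Type w} [DecidableEq ι] {R : Type*} [CommRing R]
  [Algebra R α]

/-- The generators available to express `plog L (Q)`: the products `∏_{P ∈ ρ} L P` over the set
partitions `ρ` of `Q`. [folklore] -/
def plogGen (L : Finset ι → α) (Q : Finset ι) : Set α := {x | ∃ ρ ∈ parts Q, x = ∏ P ∈ ρ, L P}

/-- `1 = ∏_∅` is the generator of `plogGen L ∅`. [folklore] -/
theorem one_mem_plogGen (L : Finset ι → α) : (1 : α) ∈ plogGen L ∅ :=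
  ⟨∅, by rw [parts_empty]; exact Finset.mem_singleton_self _, by rw [Finset.prod_empty]⟩

/-- Gluing partitions of disjoint sets: if `ρ₁ ⊢ A` and `ρ₂ ⊢ B'` with `A, B'` disjoint then
`ρ₁ ∪ ρ₂ ⊢ A ∪ B'` and `ρ₁, ρ₂` are disjoint families. [folklore] -/
theorem isPartition_glue {A B' : Finset ι} (hAB : Disjoint A B') {ρ₁ ρ₂ : Finset (Finset ι)}
    (h₁ : IsPartition A ρ₁) (h₂ : IsPartition B' ρ₂) : Disjoint ρ₁ ρ₂ ∧ IsPartition (A ∪ B') (ρ₁ ∪ ρ₂) := by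
  have hA : ρ₁.biUnion id = A := h₁.sup
  refine isPartition_union_iff.2 ⟨?_, ?_, ?_⟩
  · rw [hA]; exact Finset.subset_union_left
  · rw [hA]; exact h₁
  · rw [hA, Finset.union_sdiff_cancel_left hAB]; exact h₂

/-- Products over the parts of a partition of elements of the spans `span (plogGen L P)` lie in
`span (plogGen L B)` (refining every class by a partition gives a partition). [folklore] -/
theorem prod_mem_span_plogGen (L : Finset ι → α) (M : Finset ι → α)
    (hM : ∀ Q, M Q ∈ Submodule.span R (plogGen L Q)) {B : Finset ι} {Pt : Finset (Finset ι)}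
    (hPt : IsPartition B Pt) : ∏ P ∈ Pt, M P ∈ Submodule.span R (plogGen L B) := by
  classical
  induction Pt using Finset.induction_on generalizing B with
  | empty =>
    have hB : B = ∅ := hPt.eq_empty_iff.1 rfl
    rw [Finset.prod_empty, hB]
    exact Submodule.subset_span (one_mem_plogGen L)
  | insert a Pt ha ih =>
    set B' := Pt.biUnion id with hB'
    have hPt' : IsPartition B' Pt :=
      ⟨fun Q hQ => hPt.nonempty Q (Finset.mem_insert_of_mem hQ), fun Q hQ Q' hQ' hne =>
        hPt.disjoint Q (Finset.mem_insert_of_mem hQ) Q' (Finset.mem_insert_of_mem hQ') hne, rfl⟩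
    have haB' : Disjoint a B' := by
      rw [hB', Finset.disjoint_biUnion_right]
      intro Q hQ
      refine hPt.disjoint a (Finset.mem_insert_self _ _) Q (Finset.mem_insert_of_mem hQ) ?_
      rintro rfl; exact ha hQ
    have hBeq : B = a ∪ B' := by rw [← hPt.sup, Finset.biUnion_insert]; rfl
    have ha' : IsPartition a {a} :=
      mem_parts.1 (singleton_mem_parts (hPt.nonempty a (Finset.mem_insert_self _ _)))
    rw [Finset.prod_insert ha, hBeq]
    have hmul := Submodule.mul_mem_mul (hM a) (ih hPt')
    rw [Submodule.span_mul_span] at hmul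
    refine Submodule.span_mono ?_ hmul
    rintro x ⟨y, ⟨ρ₁, hρ₁, rfl⟩, z, ⟨ρ₂, hρ₂, rfl⟩, rfl⟩
    obtain ⟨hdj, hglue⟩ := isPartition_glue haB' (mem_parts.1 hρ₁) (mem_parts.1 hρ₂)
    exact ⟨ρ₁ ∪ ρ₂, mem_parts.2 hglue, by rw [Finset.prod_union hdj]⟩

/-- **The combinatorial logarithm exists, with integer structure**: every `L` with `L ∅ = 1` agrees
with some `pexp M` on all sets of size `≤ n`, where each `M Q` is an `R`-combination of products
`∏_{P ∈ ρ} L P` over partitions `ρ ⊢ Q` (triangular recursion `M Q = L Q − ∑_{π ≠ {Q}} ∏ M`; no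
division). [cite: Forbes2024LowDepth, §1.2] -/
theorem exists_plog (L : Finset ι → α) (hL : L ∅ = 1) (n : ℕ) :
    ∃ M : Finset ι → α, (∀ B : Finset ι, B.card ≤ n → pexp M B = L B) ∧
      ∀ Q, M Q ∈ Submodule.span R (plogGen L Q) := by
  classical
  induction n with
  | zero =>
    refine ⟨fun _ => 0, fun B hB => ?_, fun Q => Submodule.zero_mem _⟩
    have hB0 : B = ∅ := Finset.card_eq_zero.1 (Nat.le_zero.1 hB)
    rw [hB0, pexp_empty, hL]
  | succ n ih =>
    obtain ⟨M, hM, hspan⟩ := ih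
    set M' : Finset ι → α := fun Q =>
      if Q.card = n + 1 then L Q - ∑ Pt ∈ (parts Q).erase {Q}, ∏ P ∈ Pt, M P else M Q with hM'
    have hM'small : ∀ P : Finset ι, P.card ≤ n → M' P = M P := fun P hP => by
      rw [hM']; dsimp only; rw [if_neg (by omega)]
    refine ⟨M', fun B hB => ?_, fun Q => ?_⟩
    · rcases Nat.lt_or_ge B.card (n + 1) with hlt | hge
      · rw [← hM B (by omega), pexp, pexp]
        refine Finset.sum_congr rfl fun Pt hPt => Finset.prod_congr rfl fun P hP => hM'small P ?_
        have := Finset.card_le_card ((mem_parts.1 hPt).subset hP)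
        omega
      · have hcard : B.card = n + 1 := le_antisymm hB hge
        have hBne : B.Nonempty := by rw [← Finset.card_pos, hcard]; omega
        rw [pexp_eq_add_sum_erase M' hBne]
        have h1 : M' B = L B - ∑ Pt ∈ (parts B).erase {B}, ∏ P ∈ Pt, M P := by
          rw [hM']; dsimp only; rw [if_pos hcard]
        have h2 : ∑ Pt ∈ (parts B).erase {B}, ∏ P ∈ Pt, M' P =
            ∑ Pt ∈ (parts B).erase {B}, ∏ P ∈ Pt, M P :=
          Finset.sum_congr rfl fun Pt hPt => Finset.prod_congr rfl fun P hP =>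
            hM'small P (by have := card_lt_of_mem_parts_erase hPt hP; omega)
        rw [h2, h1, sub_add_cancel]
    · by_cases hQ : Q.card = n + 1
      · have hQne : Q.Nonempty := by rw [← Finset.card_pos, hQ]; omega
        have h1 : M' Q = L Q - ∑ Pt ∈ (parts Q).erase {Q}, ∏ P ∈ Pt, M P := by
          rw [hM']; dsimp only; rw [if_pos hQ]
        rw [h1]
        have hLQ : L Q ∈ plogGen L Q := ⟨{Q}, singleton_mem_parts hQne, by rw [Finset.prod_singleton]⟩
        exact Submodule.sub_mem _ (Submodule.subset_span hLQ)
          (Submodule.sum_mem _ fun Pt hPt =>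
            prod_mem_span_plogGen L M hspan (mem_parts.1 (Finset.mem_of_mem_erase hPt)))
      · have h1 : M' Q = M Q := by rw [hM']; dsimp only; rw [if_neg hQ]
        rw [h1]; exact hspan Q

end Plog

/-! ### Labelled classes: indexing the partition sums by functions `ι → ι` -/

section Labelling

variable {α : Type u} [CommRing α] {ι : Type w} [DecidableEq ι] [Fintype ι] {R : Type*}
  [CommRing R] [Algebra R α]

/-- The fibre over the label `l` of a labelling `e` restricted to `S`. [folklore] -/
def fib (S : Finset ι) (e : ι → ι) (l : ι) : Finset ι := S.filter fun i => e i = l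

/-- The product of `N` over the nonempty fibres of the labelling `e` on `S` (empty fibres
contribute the factor `1`). [folklore] -/
def labTerm (N : Finset ι → α) (S : Finset ι) (e : ι → ι) : α :=
  ∏ l, if (fib S e l).Nonempty then N (fib S e l) else 1

/-- Every set partition of `S` is the family of nonempty fibres of some labelling (label each class
by one of its own elements), so its product is a `labTerm`. [folklore] -/
theorem exists_labelling {S : Finset ι} {Pt : Finset (Finset ι)} (hPt : IsPartition S Pt) :
    ∃ e : ι → ι, ∀ N : Finset ι → α, labTerm N S e = ∏ Q ∈ Pt, N Q := by
  classical
  rcases S.eq_empty_or_nonempty with rfl | ⟨i₀, hi₀⟩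
  · have hPt0 : Pt = ∅ := hPt.eq_empty_iff.2 rfl
    refine ⟨id, fun N => ?_⟩
    rw [hPt0, Finset.prod_empty, labTerm]
    refine Finset.prod_eq_one fun l _ => ?_
    rw [if_neg]; rw [fib, Finset.filter_empty]; exact Finset.not_nonempty_empty
  haveI : Nonempty ι := ⟨i₀⟩
  have hcls : ∀ i ∈ S, ∃ Q ∈ Pt, i ∈ Q := fun i hi => by
    rw [← hPt.sup, Finset.mem_biUnion] at hi
    simpa using hi
  choose! cls hclsPt hicls using hcls
  have hrep : ∀ Q ∈ Pt, ∃ r, r ∈ Q := fun Q hQ => hPt.nonempty Q hQ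
  choose! rep hrep using hrep
  have huniq : ∀ i ∈ S, ∀ Q ∈ Pt, i ∈ Q → cls i = Q := by
    intro i hi Q hQ hiQ
    by_contra hne
    exact Finset.disjoint_left.1 (hPt.disjoint _ (hclsPt i hi) Q hQ hne) (hicls i hi) hiQ
  have hrepinj : ∀ Q ∈ Pt, ∀ Q' ∈ Pt, rep Q = rep Q' → Q = Q' := by
    intro Q hQ Q' hQ' h
    by_contra hne
    exact Finset.disjoint_left.1 (hPt.disjoint Q hQ Q' hQ' hne) (hrep Q hQ) (h ▸ hrep Q' hQ')
  refine ⟨fun i => rep (cls i), fun N => ?_⟩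
  have hfibQ : ∀ Q ∈ Pt, fib S (fun i => rep (cls i)) (rep Q) = Q := by
    intro Q hQ
    ext i
    rw [fib, Finset.mem_filter]
    constructor
    · rintro ⟨hi, h⟩
      rw [← huniq i hi Q hQ ?_]
      · exact hicls i hi
      · have := hrepinj _ (hclsPt i hi) Q hQ h
        rw [← this]; exact hicls i hi
    · intro hiQ
      have hi : i ∈ S := hPt.subset hQ hiQ
      exact ⟨hi, by rw [huniq i hi Q hQ hiQ]⟩
  have hfib0 : ∀ l, l ∉ Pt.image rep → fib S (fun i => rep (cls i)) l = ∅ := by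
    intro l hl
    rw [fib, Finset.filter_eq_empty_iff]
    intro i hi h
    exact hl (Finset.mem_image.2 ⟨cls i, hclsPt i hi, h⟩)
  rw [labTerm, ← Finset.prod_subset (Finset.subset_univ (Pt.image rep))]
  · rw [Finset.prod_image (fun Q hQ Q' hQ' h => hrepinj Q hQ Q' hQ' h)]
    refine Finset.prod_congr rfl fun Q hQ => ?_
    rw [hfibQ Q hQ, if_pos (hPt.nonempty Q hQ)]
  · intro l _ hl
    rw [hfib0 l hl, if_neg Finset.not_nonempty_empty]

/-- `pexp N (S)` is an `R`-combination (indeed a subsum) of the labelled terms `labTerm N S e`,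
`e : ι → ι`. [folklore] -/
theorem pexp_mem_span_labTerm (N : Finset ι → α) (S : Finset ι) :
    pexp N S ∈ Submodule.span R (Set.range (labTerm N S)) := by
  rw [pexp]
  refine Submodule.sum_mem _ fun Pt hPt => ?_
  obtain ⟨e, he⟩ := exists_labelling (α := α) (mem_parts.1 hPt)
  rw [← he N]
  exact Submodule.subset_span ⟨e, rfl⟩

/-- The `plog` generators of `Q` are labelled terms. [folklore] -/
theorem plogGen_subset_range_labTerm (L : Finset ι → α) (Q : Finset ι) :
    plogGen L Q ⊆ Set.range (labTerm L Q) := by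
  rintro x ⟨ρ, hρ, rfl⟩
  obtain ⟨e, he⟩ := exists_labelling (α := α) (mem_parts.1 hρ)
  exact ⟨e, he L⟩

end Labelling

end Summit.ValiantsHypothesis.ValiantsHypothesis.Theorems.SuccinctLiftSmlPlog
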